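import Literature.Topology.FourManifolds.TautFoliationsSuspensionCollar
import Mathlib.AlgebraicTopology.FundamentalGroupoid.FundamentalGroup
import HarnessLib

/-!
# A leaf whose fundamental group does not inject carries an essential loop null-homotopic in `M`

Topic: the first step of Novikov's theorem on Reeb components (S. P. Novikov, *Topology of
foliations*, Trudy Moskov. Mat. Obšč. 14 (1965); Camacho–Lins Neto, *Geometric Theory of
Foliations*, Ch. VII §2, the hypothesis of the existence of vanishing cycles: "a closed curve
`γ` in a leaf `A`, not null-homotopic in `A` but null-homotopic in `M`"). We pass from the
group-theoretic hypothesis of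
`Literature.Topology.FourManifolds.Foliation.fundamentalGroup_map_injective_of_isTaut` — the
homomorphism `π₁(L, p) → π₁(M, p)` induced by the inclusion of the compact leaf `L = F.leaf x`
*with the topology induced from `M`* is not injective — to the geometric datum used by the
theory of holonomy and fences: **a loop of the leaf in its leaf topology, not null-homotopic
there, whose image in `M` is null-homotopic** (a compact leaf carries the induced topology,
`leafHomeomorphOfIsCompact`: closed leaves are proper).

* `exists_loop_of_not_injective` (**proved**): for a continuous map `f`, if `π₁(f)` is not
  injective at `x` then some loop at `x` is not null-homotopic while its image is.
* `Foliation.exists_essential_loop_of_not_injective` (**proved**): the leafwise version for a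
  compact leaf.

All statements are [folklore].
-/

noncomputable section

open Set Function
open scoped Topology unitInterval

namespace Literature.Topology.FourManifolds

/-- **If `π₁(f)` is not injective at `x`, some loop at `x` is essential with null-homotopic
image.** [folklore] -/
theorem exists_loop_of_not_injective {X Y : Type*} [TopologicalSpace X] [TopologicalSpace Y] (f : C(X, Y)) (x : X)
    (h : ¬ Injective (FundamentalGroup.map f x)) :
    ∃ γ : Path x x, ¬ γ.Homotopic (Path.refl x) ∧ (γ.map f.continuous).Homotopic (Path.refl (f x)) := by
  rw [injective_iff_map_eq_one] at h
  push Not at h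
  obtain ⟨a, ha1, hane⟩ := h
  induction a using Path.Homotopic.Quotient.ind with
  | mk γ =>
    refine ⟨γ, fun hγ ↦ hane ?_, ?_⟩
    · rw [FundamentalGroup.one_def, ← Path.Homotopic.Quotient.mk_refl]
      exact Path.Homotopic.Quotient.eq.2 hγ
    · have h1 : (FundamentalGroup.map f x) (Path.Homotopic.Quotient.mk γ) =
          Path.Homotopic.Quotient.mk (γ.map f.continuous) := by
        rw [Path.Homotopic.Quotient.mk_map]
        rfl
      rw [h1, FundamentalGroup.one_def, ← Path.Homotopic.Quotient.mk_refl] at ha1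
      exact Path.Homotopic.Quotient.eq.1 ha1

namespace Foliation

variable {B : Type*} [NormedAddCommGroup B] [Nonempty B]
variable {M : Type*} [TopologicalSpace M] [T2Space M] [SecondCountableTopology M] (F : Foliation B M) {x : M}

/-- **A compact leaf whose fundamental group (in the induced topology) does not inject into that
of `M` carries a leafwise loop, not null-homotopic in the leaf space, null-homotopic in `M`.**
The loop of the induced topology is leafwise continuous because a compact leaf carries the
induced topology (`leafHomeomorphOfIsCompact`); a null-homotopy of it in the leaf space would
run in the leaf (a clopen subset of the leaf space) and transport back to the induced topology.
[folklore] -/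
theorem exists_essential_leafLoop_of_not_injective [PreconnectedSpace B] (hK : IsCompact (F.leaf x)) (p : F.leaf x)
    (h : ¬ Injective (FundamentalGroup.map (⟨Subtype.val, continuous_subtype_val⟩ : C(F.leaf x, M)) p)) :
    ∃ (γ : Path (p : M) (p : M)) (hγ : Continuous (toLeafSpace ∘ γ : I → F.LeafSpace)),
      (∀ t, γ t ∈ F.leaf x) ∧ ¬ (F.leafLoop γ hγ).Homotopic (Path.refl _) ∧ γ.Homotopic (Path.refl (p : M)) := by
  obtain ⟨γ₀, hess, hnull⟩ := exists_loop_of_not_injective _ p h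
  set e := F.leafHomeomorphOfIsCompact hK with he
  set γ : Path (p : M) (p : M) := γ₀.map continuous_subtype_val with hγdef
  -- leafwise continuity: through the leaf topology via `e.symm`
  have hγ : Continuous (toLeafSpace ∘ γ : I → F.LeafSpace) := by
    have h1 : (toLeafSpace ∘ γ : I → F.LeafSpace) = (fun q : F.Leaf x ↦ (q : F.LeafSpace)) ∘ e.symm ∘ γ₀ := by
      funext t; rfl
    rw [h1]
    exact continuous_subtype_val.comp (e.symm.continuous.comp γ₀.continuous)
  refine ⟨γ, hγ, fun t ↦ (γ₀ t).2, fun H ↦ hess ?_, hnull⟩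
  -- a null-homotopy in the leaf space runs in the leaf and transports back
  obtain ⟨H⟩ := H
  have hclopen := F.isClopen_preimage_leaf x
  have hmem : ∀ z : I × I, H z ∈ (ofLeafSpace ⁻¹' F.leaf x : Set F.LeafSpace) := by
    have hpre : IsClopen (H ⁻¹' (ofLeafSpace ⁻¹' F.leaf x)) := hclopen.preimage H.continuous
    have huniv := hpre.eq_univ ⟨(0, 0), by
      show ofLeafSpace (H (0, 0)) ∈ F.leaf x
      rw [H.apply_zero]
      exact (γ₀ 0).2⟩
    intro z
    have hz : z ∈ H ⁻¹' (ofLeafSpace ⁻¹' F.leaf x) := by rw [huniv]; exact mem_univ z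
    exact hz
  refine ⟨{ toFun := fun z ↦ e ⟨H z, hmem z⟩
            continuous_toFun := e.continuous.comp (H.continuous.subtype_mk _)
            map_zero_left := fun t ↦ ?_
            map_one_left := fun t ↦ ?_
            prop' := fun s t ht ↦ ?_ }⟩
  · show e ⟨H (0, t), hmem (0, t)⟩ = γ₀ t
    have h0 : (⟨H (0, t), hmem (0, t)⟩ : F.Leaf x) = e.symm (γ₀ t) := Subtype.ext (H.apply_zero t)
    rw [h0, e.apply_symm_apply]
  · show e ⟨H (1, t), hmem (1, t)⟩ = p
    have h1 : (⟨H (1, t), hmem (1, t)⟩ : F.Leaf x) = e.symm p := Subtype.ext (H.apply_one t)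
    rw [h1, e.apply_symm_apply]
  · show e ⟨H (s, t), hmem (s, t)⟩ = γ₀ t
    have hs : (⟨H (s, t), hmem (s, t)⟩ : F.Leaf x) = e.symm (γ₀ t) := by
      apply Subtype.ext
      show H (s, t) = (F.leafLoop γ hγ) t
      exact H.prop s t ht
    rw [hs, e.apply_symm_apply]

end Foliation

end Literature.Topology.FourManifolds
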